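import Mathlib
import HarnessLib
import Summits.Ventures.LatticeQCDFlow.Exactness.U1MetropolisSweepErgodic
import Summits.Ventures.LatticeQCDFlow.Exactness.U1LeapfrogHMCWilson

/-!
# The `U(1)` Metropolis sweep is exact on the product space and converges to the torus Wilson measure from every start

HONEST FRAMING: exact (Metropolis-corrected) sampling algorithms for lattice gauge theory;
figures of merit are autocorrelation/cost numbers at stated couplings and volumes; no
continuum-physics claim.

Venture `LatticeQCDFlow` (cell pub-lqcd), topic `Exactness`, FANOUT row 9 (eng-latcore, the
engine `latflow.core.u1_2d.U1Field2D.sweep_metropolis(β, step, nhit)`).  NEW WORK of the cell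
over the tree (`U1MetropolisSweepErgodic.lean`: the sweep `u1MetropolisSweep` on `ι → U(1)` and its
Doeblin minorant; `SymmetricMetropolis.lean`: `symMH_invariant`, `compProd_mulWalk_swap`;
`RefreshScan.lean`: `lintegral_siteLift`, `lintegral_pi_lmarginal`; `InvariantComposition.lean`;
`U1LeapfrogHMCWilson.lean`: `u1GibbsLaw_eq_wilsonMeasure`; Literature `wilsonMeasure`); nothing
here is cited as a fact.  This file removes the one abstraction left in
`u1MetropolisSweep_uniformlyErgodic` ("to any invariant probability law"):

* §1 **`compProd_u1LinkProposal_swap`** — the site-lifted random walk (kick link `l` by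
  `e^{iθ}`, `|θ| < s`) is symmetric with respect to product Haar measure on the FULL configuration
  space: `(Haar^{⊗ι} ⊗ P_l)∘swap⁻¹ = Haar^{⊗ι} ⊗ P_l` (tower property over link `l` + the one-link
  symmetry `compProd_mulWalk_swap`); hence **`u1LinkHit_invariant`** — every link hit leaves
  `w · Haar^{⊗ι}` invariant for every measurable `w > 0` (`symMH_invariant`), and
  **`u1MetropolisSweep_invariant`** — so does the sweep (any `n`, any scan).
* §2 **`wilson_u1MetropolisSweep_uniformlyErgodic`** — ENGINE INSTANCE: torus `(ℤ/L)^d`,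
  `G = U(1)`, any real `β`, continuous representation `ρ`, kick size `s > 0`, `nhit = n ≥ 2^j` with
  `(3/2)^j s ≥ π`, a scan visiting every link: there is `ε ∈ (0, 1]` with
  `|μ₀Kᵗ(A) − μ_{Λ,β}(A)| ≤ (1 − ε)ᵗ` for every initial law `μ₀`, every `t`, every set `A` —
  the Metropolis sweep converges to the Literature's `wilsonMeasure ρ β` from every start;
  **`wilsonMeasure_unique_invariant_u1MetropolisSweep`** — the Wilson measure is its only invariant
  probability law.

NOT here: the default `(step, nhit) = (1.0, 4)` (needs `(9/4)·step ≥ π`, i.e. `step ≥ 1.40`, or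
`nhit = 8` at `step = 1.0` — the cross-sweep accumulation of kicks is not assembled); `SU(2)` /
`SU(N)` Metropolis (non-commuting kicks); any useful constant.
-/

noncomputable section

namespace Summit.Ventures.LatticeQCDFlow.Exactness

open MeasureTheory ProbabilityTheory ProbabilityTheory.Kernel Set Metric Function
open Literature.MathematicalPhysics.QuantumFieldTheory
open scoped ENNReal

/-! ## §1 The site-lifted random walk is symmetric for product Haar measure; the sweep is exact -/

section Exact

variable {ι : Type*} [DecidableEq ι] [Fintype ι] {s : ℝ} {w : (ι → Circle) → ℝ}

/-- The one-link symmetry in integral form: for the Haar probability of `U(1)` and the inversion-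
invariant step law, `∫∫ F(Vu, u) = ∫∫ F(u, Vu)`. -/
theorem lintegral_kick_swap (s : ℝ) {F : Circle → Circle → ℝ≥0∞} (hF : Measurable (uncurry F)) :
    ∫⁻ u, ∫⁻ V, F (V * u) u ∂(u1KickLaw s) ∂(haarProbability Circle) =
      ∫⁻ u, ∫⁻ V, F u (V * u) ∂(u1KickLaw s) ∂(haarProbability Circle) := by
  haveI := isInvInvariant_u1KickLaw s
  have hF' : Measurable fun z : Circle × Circle => F z.2 z.1 := hF.comp measurable_swap
  calc ∫⁻ u, ∫⁻ V, F (V * u) u ∂(u1KickLaw s) ∂(haarProbability Circle)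
      = ∫⁻ u, ∫⁻ y, F y u ∂(mulWalk (u1KickLaw s) u) ∂(haarProbability Circle) :=
        lintegral_congr fun u => (lintegral_mulWalk _ u (g := fun y => F y u)
          (hF.comp (measurable_id.prodMk measurable_const))).symm
    _ = ∫⁻ z, F z.2 z.1 ∂(haarProbability Circle ⊗ₘ mulWalk (u1KickLaw s)) :=
        (Measure.lintegral_compProd hF').symm
    _ = ∫⁻ z, F z.2 z.1 ∂((haarProbability Circle ⊗ₘ mulWalk (u1KickLaw s)).map Prod.swap) := by
        rw [compProd_mulWalk_swap]
    _ = ∫⁻ z, F z.1 z.2 ∂(haarProbability Circle ⊗ₘ mulWalk (u1KickLaw s)) := by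
        rw [lintegral_map hF' measurable_swap]
        rfl
    _ = ∫⁻ u, ∫⁻ y, F u y ∂(mulWalk (u1KickLaw s) u) ∂(haarProbability Circle) :=
        Measure.lintegral_compProd hF
    _ = ∫⁻ u, ∫⁻ V, F u (V * u) ∂(u1KickLaw s) ∂(haarProbability Circle) :=
        lintegral_congr fun u => lintegral_mulWalk _ u (g := fun y => F u y) (hF.comp measurable_prodMk_left)

/-- **Symmetry of the sweep's proposal with respect to product Haar measure**:
`(Haar^{⊗ι} ⊗ P_l)∘swap⁻¹ = Haar^{⊗ι} ⊗ P_l` for the kick of link `l`. -/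
theorem compProd_u1LinkProposal_swap (l : ι) :
    ((Measure.pi fun _ : ι => haarProbability Circle) ⊗ₘ u1LinkProposal s l).map Prod.swap =
      (Measure.pi fun _ : ι => haarProbability Circle) ⊗ₘ u1LinkProposal s l := by
  refine Measure.ext_of_lintegral _ (fun f hf => ?_)
  rw [lintegral_map hf measurable_swap,
    Measure.lintegral_compProd (f := fun z : (ι → Circle) × (ι → Circle) => f z.swap) (hf.comp measurable_swap),
    Measure.lintegral_compProd hf]
  show ∫⁻ U, ∫⁻ y, f (y, U) ∂(u1LinkProposal s l U) ∂(Measure.pi fun _ : ι => haarProbability Circle) =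
    ∫⁻ U, ∫⁻ y, f (U, y) ∂(u1LinkProposal s l U) ∂(Measure.pi fun _ : ι => haarProbability Circle)
  -- the proposal integrates as the one-link kick
  have hP : ∀ (U : ι → Circle) (g : (ι → Circle) → ℝ≥0∞), Measurable g →
      ∫⁻ y, g y ∂(u1LinkProposal s l U) = ∫⁻ V, g (update U l (V * U l)) ∂(u1KickLaw s) := by
    intro U g hg
    rw [u1LinkProposal, lintegral_siteLift _ _ _ hg, Kernel.comap_apply,
      lintegral_mulWalk _ _ (g := fun ξ => g (update U l ξ))
        (show Measurable (fun ξ => g (update U l ξ)) from hg.comp (measurable_update U))]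
  have h1 : ∀ U : ι → Circle, ∫⁻ y, f (y, U) ∂(u1LinkProposal s l U) =
      ∫⁻ V, f (update U l (V * U l), U) ∂(u1KickLaw s) := fun U =>
    hP U (fun y => f (y, U)) (hf.comp (measurable_id.prodMk measurable_const))
  have h2 : ∀ U : ι → Circle, ∫⁻ y, f (U, y) ∂(u1LinkProposal s l U) =
      ∫⁻ V, f (U, update U l (V * U l)) ∂(u1KickLaw s) := fun U =>
    hP U (fun y => f (U, y)) (hf.comp measurable_prodMk_left)
  simp_rw [h1, h2]
  -- measurability of the two inner integrals as functions of `U`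
  have hupd : Measurable fun p : (ι → Circle) × Circle => update p.1 l (p.2 * p.1 l) :=
    measurable_update'.comp (measurable_fst.prodMk (measurable_snd.mul ((measurable_pi_apply l).comp measurable_fst)))
  have hG₁ : Measurable fun U : ι → Circle => ∫⁻ V, f (update U l (V * U l), U) ∂(u1KickLaw s) :=
    Measurable.lintegral_prod_right (f := fun (U : ι → Circle) (V : Circle) => f (update U l (V * U l), U))
      (hf.comp (hupd.prodMk measurable_fst))
  have hG₂ : Measurable fun U : ι → Circle => ∫⁻ V, f (U, update U l (V * U l)) ∂(u1KickLaw s) :=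
    Measurable.lintegral_prod_right (f := fun (U : ι → Circle) (V : Circle) => f (U, update U l (V * U l)))
      (hf.comp (measurable_fst.prodMk hupd))
  -- tower property over link `l`: `U = update U l u`, `u ∼ Haar`
  rw [← lintegral_pi_lmarginal (μ := fun _ : ι => haarProbability Circle) l hG₁,
    ← lintegral_pi_lmarginal (μ := fun _ : ι => haarProbability Circle) l hG₂]
  simp only [lmarginal_singleton, update_idem, update_self]
  -- the one-link symmetry, frozen environment `U`
  refine lintegral_congr fun U => ?_
  exact lintegral_kick_swap s (F := fun a b => f (update U l a, update U l b))
    (hf.comp (((measurable_update U).comp measurable_fst).prodMk ((measurable_update U).comp measurable_snd)))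

/-- **Every link hit of the sweep leaves `w · Haar^{⊗ι}` invariant**, for every measurable
`w > 0` (the joint weight `e^{−S}`), every `s > 0`, every link. -/
theorem u1LinkHit_invariant (hs : 0 < s) (hw : Measurable w) (hw0 : ∀ U, 0 < w U) (l : ι) :
    Kernel.Invariant (u1LinkHit s w l)
      ((Measure.pi fun _ : ι => haarProbability Circle).withDensity fun U => ENNReal.ofReal (w U)) := by
  haveI := isProbabilityMeasure_u1KickLaw hs
  haveI : IsMarkovKernel (u1LinkProposal s l : Kernel (ι → Circle) _) := by
    unfold u1LinkProposal; infer_instance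
  unfold u1LinkHit
  exact symMH_invariant hw hw0 (compProd_u1LinkProposal_swap l)

/-- **The Metropolis sweep is exact on the product space**: it leaves `w · Haar^{⊗ι}` invariant
(any number of hits per visit, any scan). -/
theorem u1MetropolisSweep_invariant (hs : 0 < s) (hw : Measurable w) (hw0 : ∀ U, 0 < w U) (n : ℕ)
    (L : List ι) :
    Kernel.Invariant (u1MetropolisSweep s w n L)
      ((Measure.pi fun _ : ι => haarProbability Circle).withDensity fun U => ENNReal.ofReal (w U)) := by
  refine invariant_cycle fun κ hκ => ?_
  obtain ⟨l, -, rfl⟩ := List.mem_map.1 hκ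
  exact invariant_nHit (u1LinkHit_invariant hs hw hw0 l) n

end Exact

/-! ## §2 Engine instance: convergence to the torus Wilson measure of `U(1)` from every start -/

section Wilson

variable {ι : Type*} [DecidableEq ι] [Fintype ι]

/-- The Doeblin constant of the sweep is non-zero (for `s > 0`, `0 < m`, `0 < M`). -/
theorem sweepDoeblinConst_ne_zero {s m M : ℝ} (hs : 0 < s) (hm : 0 < m) (hM : 0 < M) (j n k : ℕ) :
    (ENNReal.ofReal (m / M) ^ n *
        ((ENNReal.ofReal (2 * s))⁻¹ ^ 2 ^ j * (doublingConst s j * ENNReal.ofReal (2 * Real.pi)))) ^ k ≠ 0 := by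
  refine pow_ne_zero _ (mul_ne_zero (pow_ne_zero _ ?_) (mul_ne_zero
    (pow_ne_zero _ (ENNReal.inv_ne_zero.2 ENNReal.ofReal_ne_top))
    (mul_ne_zero (doublingConst_ne_zero hs j) ?_)))
  · rw [Ne, ENNReal.ofReal_eq_zero, not_le]; exact div_pos hm hM
  · rw [Ne, ENNReal.ofReal_eq_zero, not_le]; positivity

variable {d L N : ℕ} (ρ : Circle →* Matrix (Fin N) (Fin N) ℂ)

/-- The Wilson weight `U ↦ e^{−β S_W(U)}` of `U(1)` is measurable (it is continuous). -/
theorem measurable_wilsonBoltzmann [NeZero L] (hρ : Continuous ρ) (β : ℝ) :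
    Measurable fun U : GaugeConfig d L Circle => Real.exp (-β * wilsonAction ρ U) :=
  (Real.continuous_exp.comp (continuous_smul_wilsonAction ρ hρ (-β))).measurable

/-- **THE `U(1)` METROPOLIS SWEEP CONVERGES TO THE WILSON MEASURE FROM EVERY START.**  Torus
`(ℤ/L)^d`, `G = U(1)` with a continuous representation `ρ`, any real `β`; the engine's sweep with
kick size `s > 0`, `n ≥ 2^j` hits per link where `(3/2)^j s ≥ π`, over a scan `Ls` visiting every
link, joint weight `e^{−βS_W}`: there is `ε ∈ (0, 1]` with `|μ₀Kᵗ(A) − μ_{Λ,β}(A)| ≤ (1 − ε)ᵗ` for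
every initial law `μ₀`, every `t`, every set `A`. -/
theorem wilson_u1MetropolisSweep_uniformlyErgodic [NeZero L] (hρ : Continuous ρ) (β : ℝ) {s : ℝ}
    (hs : 0 < s) {j n : ℕ} (hj : Real.pi ≤ doublingRadius s j) (hn : 2 ^ j ≤ n)
    {Ls : List (Edge d L)} (hLs : ∀ e, e ∈ Ls) :
    ∃ ε : ℝ, 0 < ε ∧ ε ≤ 1 ∧
      ∀ (μ₀ : Measure (GaugeConfig d L Circle)) [IsProbabilityMeasure μ₀] (t : ℕ)
        (A : Set (GaugeConfig d L Circle)),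
        |((fun ν : Measure (GaugeConfig d L Circle) =>
              ν.bind (u1MetropolisSweep s (fun U => Real.exp (-β * wilsonAction ρ U)) n Ls))^[t] μ₀).real A
            - (wilsonMeasure ρ β).real A| ≤ (1 - ε) ^ t := by
  obtain ⟨s₀, hs₀⟩ := exists_bound_smul_wilsonAction_circle (d := d) (L := L) ρ hρ β
  have hwm := measurable_wilsonBoltzmann (d := d) (L := L) ρ hρ β
  have hw0 : ∀ U : GaugeConfig d L Circle, 0 < Real.exp (-β * wilsonAction ρ U) := fun U => Real.exp_pos _
  have hwlo : ∀ U : GaugeConfig d L Circle, Real.exp (-s₀) ≤ Real.exp (-β * wilsonAction ρ U) := fun U => by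
    rw [Real.exp_le_exp, neg_mul]; exact neg_le_neg (abs_le.1 (hs₀ U)).2
  have hwhi : ∀ U : GaugeConfig d L Circle, Real.exp (-β * wilsonAction ρ U) ≤ Real.exp s₀ := fun U => by
    rw [Real.exp_le_exp, neg_mul]; linarith [(abs_le.1 (hs₀ U)).1]
  haveI : IsProbabilityMeasure (wilsonMeasure (d := d) (L := L) ρ β) := by
    rw [← u1GibbsLaw_eq_wilsonMeasure (d := d) (L := L) ρ β]
    exact isProbabilityMeasure_u1GibbsLaw (ι := Edge d L) hs₀
  haveI := isMarkovKernel_u1MetropolisSweep (s := s) hs hwm n Ls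
  have hπ : Kernel.Invariant (u1MetropolisSweep s (fun U => Real.exp (-β * wilsonAction ρ U)) n Ls)
      (wilsonMeasure (d := d) (L := L) ρ β) := by
    show Kernel.Invariant _ ((partitionFunction (d := d) (L := L) ρ β)⁻¹ • wilsonWeight ρ β)
    exact invariant_smul (u1MetropolisSweep_invariant hs hwm hw0 n Ls) _
  have hmin := u1MetropolisSweep_minorised hs hwm (Real.exp_pos (-s₀)) hwlo hwhi hj hn hLs
  set δ := (ENNReal.ofReal (Real.exp (-s₀) / Real.exp s₀) ^ n *
      ((ENNReal.ofReal (2 * s))⁻¹ ^ 2 ^ j * (doublingConst s j * ENNReal.ofReal (2 * Real.pi)))) ^ Ls.length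
    with hδ
  have hδ0 : δ ≠ 0 := sweepDoeblinConst_ne_zero hs (Real.exp_pos _) (Real.exp_pos _) j n Ls.length
  have hδ1 : δ ≤ 1 := by
    have h := Measure.le_iff'.1 (hmin fun _ => 1) univ
    rwa [Measure.smul_apply, smul_eq_mul, measure_univ, measure_univ, mul_one] at h
  have hδtop : δ ≠ ⊤ := ne_top_of_le_ne_top ENNReal.one_ne_top hδ1
  refine ⟨δ.toReal, ENNReal.toReal_pos hδ0 hδtop,
    ENNReal.toReal_le_of_le_ofReal zero_le_one (by rwa [ENNReal.ofReal_one]), fun μ₀ _ t A => ?_⟩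
  exact uniformlyErgodic_of_minorised hmin hπ μ₀ t A

/-- **The Wilson measure is the unique invariant probability law of the `U(1)` Metropolis sweep**
(same hypotheses). -/
theorem wilsonMeasure_unique_invariant_u1MetropolisSweep [NeZero L] (hρ : Continuous ρ) (β : ℝ)
    {s : ℝ} (hs : 0 < s) {j n : ℕ} (hj : Real.pi ≤ doublingRadius s j) (hn : 2 ^ j ≤ n)
    {Ls : List (Edge d L)} (hLs : ∀ e, e ∈ Ls) {π' : Measure (GaugeConfig d L Circle)}
    [IsProbabilityMeasure π']
    (hπ' : Kernel.Invariant (u1MetropolisSweep s (fun U => Real.exp (-β * wilsonAction ρ U)) n Ls) π') :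
    π' = wilsonMeasure ρ β := by
  obtain ⟨s₀, hs₀⟩ := exists_bound_smul_wilsonAction_circle (d := d) (L := L) ρ hρ β
  have hwm := measurable_wilsonBoltzmann (d := d) (L := L) ρ hρ β
  have hw0 : ∀ U : GaugeConfig d L Circle, 0 < Real.exp (-β * wilsonAction ρ U) := fun U => Real.exp_pos _
  have hwlo : ∀ U : GaugeConfig d L Circle, Real.exp (-s₀) ≤ Real.exp (-β * wilsonAction ρ U) := fun U => by
    rw [Real.exp_le_exp, neg_mul]; exact neg_le_neg (abs_le.1 (hs₀ U)).2
  have hwhi : ∀ U : GaugeConfig d L Circle, Real.exp (-β * wilsonAction ρ U) ≤ Real.exp s₀ := fun U => by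
    rw [Real.exp_le_exp, neg_mul]; linarith [(abs_le.1 (hs₀ U)).1]
  haveI : IsProbabilityMeasure (wilsonMeasure (d := d) (L := L) ρ β) := by
    rw [← u1GibbsLaw_eq_wilsonMeasure (d := d) (L := L) ρ β]
    exact isProbabilityMeasure_u1GibbsLaw (ι := Edge d L) hs₀
  haveI := isMarkovKernel_u1MetropolisSweep (s := s) hs hwm n Ls
  have hπ : Kernel.Invariant (u1MetropolisSweep s (fun U => Real.exp (-β * wilsonAction ρ U)) n Ls)
      (wilsonMeasure (d := d) (L := L) ρ β) := by
    show Kernel.Invariant _ ((partitionFunction (d := d) (L := L) ρ β)⁻¹ • wilsonWeight ρ β)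
    exact invariant_smul (u1MetropolisSweep_invariant hs hwm hw0 n Ls) _
  exact invariant_unique_of_minorised (u1MetropolisSweep_minorised hs hwm (Real.exp_pos (-s₀)) hwlo hwhi hj hn hLs)
    (pos_iff_ne_zero.2 (sweepDoeblinConst_ne_zero hs (Real.exp_pos _) (Real.exp_pos _) j n Ls.length))
    hπ hπ'

end Wilson

end Summit.Ventures.LatticeQCDFlow.Exactness
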